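import Literature.Probability.LatticeModels.SixVertexCylinderLimit
import Literature.LinearAlgebra.Matrix.PrimitiveSymmetricPerron

/-!
# Six-vertex model: the balanced transfer matrix has a single block — particle hops, adjacent
# transpositions, a positive power, and simplicity of the largest eigenvalue (DKLM 2026, Lemma 57)

H. Duminil-Copin, K. K. Kozlowski, P. Lammers, I. Manolescu, *Gaussian free field convergence of
the six-vertex model with `-1 ≤ Δ ≤ -1/2`*, arXiv:2603.06268 (2026) [DKLM2026SixVertexGFF]
(`paper:arxiv-2603.06268`, chunk p0041):

> **Lemma 57** (Basic properties of the transfer matrix). The operator `t(π/2)` is a Hermitian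
> Perron–Frobenius matrix with a single block. Therefore, it is diagonal in some orthonormal basis
> `(v_k)_k` with real eigenvalues […] `λ_0(π/2) > |λ_1(π/2)| ≥ …`. Finally, `v_0` may be chosen
> such that it has positive real entries in the basis `(e_κ)_κ`.
> *Proof.* […] It is easy to see that `t(π/2)^k` has positive entries for sufficiently large `k`.
> As a consequence, it has a single block. The rest follows.
> **Remark 58.** The eigenspace of `T(π/2)` associated with the top eigenvalue `1` is
> one-dimensional. […] The spectrum of `T(π/2)` is supported on `(-1, 1]`.

This file supplies the "easy to see" combinatorics for the balanced transfer matrix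
`t_𝔅 = balancedTransferMatrix 1 1 c` (`a = b = 1`, `c > 0`) of `SixVertexTransferMatrix.lean`
and concludes with the matrix results of `Literature/LinearAlgebra/Matrix/PrimitiveSymmetricPerron.lean`:

1. **Particle hops.** `hop κ y₀` moves the east arrow at row `y₀` to row `y₀ + 1`; with the
   vertical arrows `α = 𝟙_{y₀}` (only the edge above row `y₀` points north) the column
   `(κ, α, hop κ y₀)` satisfies the ice rule at every vertex, so `t(κ, hop κ y₀) > 0`
   (`columnWeight_hop_pos`, `transferMatrix_hop_pos`); hops preserve balancedness
   (`isBalancedCol_hop`).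
2. **Adjacent transpositions.** `t_𝔅` is symmetric, so reachability in its positivity graph is an
   equivalence relation; precomposing a balanced column with the transposition of two adjacent
   rows is the identity, a hop, or an inverse hop (`reach_comp_swap`). Adjacent transpositions
   generate the symmetric group (`Equiv.Perm.mclosure_swap_castSucc_succ`) and any two balanced
   columns differ by a permutation of the rows (`exists_perm_comp_eq`), hence **all balanced
   columns are mutually reachable** (`reach_balancedTransferMatrix`).
3. **Lemma 57.** `exists_balancedTransferMatrix_pow_pos` (a positive power: a single block),
   **`card_filter_eigenvalues_balancedTransferMatrix_eq_one`** (the largest eigenvalue `Λ` of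
   `t_𝔅` is simple: `d = 1` in `SixVertexCylinderLimit.lean` / eq. (cylop)) and
   `exists_pos_eigenvector_balancedTransferMatrix` (a Perron vector `v_0` with positive entries),
   for the torus circumference `L = 2(ℓ+1)`.

## References

* H. Duminil-Copin, K. K. Kozlowski, P. Lammers, I. Manolescu, arXiv:2603.06268 (2026), Part III
  §1, Lemma 57, Remark 58. [DKLM2026SixVertexGFF]
* J. Ding, A. Zhou, *Nonnegative Matrices, Positive Operators, and Applications* (2009), §2.1
  (Perron's theorem, via `PrimitiveSymmetricPerron.lean`). [DingZhou2009]
-/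

noncomputable section

open Finset Matrix
open Literature.LinearAlgebra.Matrix

namespace Literature.Probability.LatticeModels.SixVertex

/-! ## 1. Particle hops -/

section Hop

variable {G₂ : Type*} [AddGroup G₂] [One G₂] [Fintype G₂] [DecidableEq G₂]

/-- **The particle hop**: the east arrow at row `y₀` of the column configuration `κ` moves to
row `y₀ + 1` (used when `κ y₀ = true`, `κ (y₀ + 1) = false`). [cite: DKLM2026SixVertexGFF, Lemma 57 (proof)] -/
def hop (κ : G₂ → Bool) (y₀ : G₂) : G₂ → Bool :=
  Function.update (Function.update κ y₀ false) (y₀ + 1) true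

omit [Fintype G₂] in
/-- After the hop, row `y₀ + 1` carries an east arrow. [folklore] -/
theorem hop_apply_add_one (κ : G₂ → Bool) (y₀ : G₂) : hop κ y₀ (y₀ + 1) = true := by
  simp [hop]

omit [Fintype G₂] in
/-- After the hop, row `y₀` carries a west arrow (`1 ≠ 0` in `G₂`). [folklore] -/
theorem hop_apply_self (h1 : (1 : G₂) ≠ 0) (κ : G₂ → Bool) (y₀ : G₂) : hop κ y₀ y₀ = false := by
  have h : y₀ ≠ y₀ + 1 := fun h => h1 (by simpa using h.symm)
  simp [hop, h]

omit [Fintype G₂] in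
/-- The hop does not change the other rows. [folklore] -/
theorem hop_apply_of_ne (κ : G₂ → Bool) {y₀ y : G₂} (hy : y ≠ y₀) (hy' : y ≠ y₀ + 1) :
    hop κ y₀ y = κ y := by
  simp [hop, hy, hy']

omit [Fintype G₂] [DecidableEq G₂] in
/-- Every vertex type allowed by the ice rule has positive weight for `a = b = 1`, `c > 0`.
[cite: DKLM2026SixVertexGFF, Def. 2.1] -/
theorem localWeight_pos_of_ice {c : ℝ} (hc : 0 < c) {E W N S : Bool}
    (h : (if E = true then 0 else 1) + (if W = true then 1 else 0) + (if N = true then 0 else 1) +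
        (if S = true then 1 else 0) = 2) :
    0 < localWeight 1 1 c E W N S := by
  unfold localWeight
  rw [if_pos h]
  split_ifs <;> first | exact one_pos | exact hc

/-- **The hop column satisfies the ice rule**: with vertical arrows `α = 𝟙_{y₀}` the column
`(κ, α, hop κ y₀)` has positive weight whenever `κ y₀ = true`, `κ (y₀+1) = false`.
[cite: DKLM2026SixVertexGFF, Lemma 57 (proof: "it may be checked directly")] -/
theorem columnWeight_hop_pos {c : ℝ} (hc : 0 < c) (h1 : (1 : G₂) ≠ 0) (κ : G₂ → Bool)
    (y₀ : G₂) (hy : κ y₀ = true) (hy' : κ (y₀ + 1) = false) :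
    0 < columnWeight 1 1 c κ (hop κ y₀) (fun y => decide (y = y₀)) := by
  have hne : y₀ + 1 ≠ y₀ := fun h => h1 (by simpa using h)
  have hne' : y₀ - 1 ≠ y₀ := fun h => h1 (by simpa using h)
  unfold columnWeight
  refine Finset.prod_pos fun y _ => localWeight_pos_of_ice hc ?_
  by_cases h0 : y = y₀
  · subst h0
    rw [hop_apply_self h1, hy]
    simp [hne']
  · by_cases h0' : y = y₀ + 1
    · subst h0'
      rw [hop_apply_add_one, hy']
      simp [hne]
    · have hsub : y - 1 ≠ y₀ := fun h => h0' (by rw [← h, sub_add_cancel])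
      rw [hop_apply_of_ne κ h0 h0']
      cases κ y <;> simp [h0, hsub]

/-- **`t(κ, hop κ y₀) > 0`**: a hop is a positive entry of the transfer matrix (`a = b = 1`,
`c > 0`). [cite: DKLM2026SixVertexGFF, Lemma 57 (proof)] -/
theorem transferMatrix_hop_pos {c : ℝ} (hc : 0 < c) (h1 : (1 : G₂) ≠ 0) (κ : G₂ → Bool) (y₀ : G₂)
    (hy : κ y₀ = true) (hy' : κ (y₀ + 1) = false) :
    0 < transferMatrix 1 1 c κ (hop κ y₀) := by
  simp only [transferMatrix, Matrix.of_apply]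
  refine lt_of_lt_of_le (columnWeight_hop_pos hc h1 κ y₀ hy hy') ?_
  exact Finset.single_le_sum (f := fun α => columnWeight 1 1 c κ (hop κ y₀) α)
    (fun α _ => columnWeight_nonneg zero_le_one zero_le_one hc.le _ _ _) (Finset.mem_univ _)

omit [AddGroup G₂] [One G₂] [DecidableEq G₂] in
/-- Precomposition with a permutation of the rows preserves the number of east arrows. [folklore] -/
theorem card_filter_apply_perm (κ : G₂ → Bool) (σ : Equiv.Perm G₂) :
    (Finset.univ.filter fun y => κ (σ y) = true).card =
      (Finset.univ.filter fun y => κ y = true).card := by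
  refine Finset.card_bij (fun y _ => σ y) (fun y hy => by simpa using hy)
    (fun _ _ _ _ h => σ.injective h) (fun y hy => ⟨σ.symm y, by simpa using hy, by simp⟩)

omit [AddGroup G₂] [One G₂] [DecidableEq G₂] in
/-- Precomposition with a permutation of the rows preserves balancedness. [folklore] -/
theorem isBalancedCol_comp_perm {κ : G₂ → Bool} (hκ : IsBalancedCol κ) (σ : Equiv.Perm G₂) :
    IsBalancedCol (κ ∘ σ) := by
  unfold IsBalancedCol at hκ ⊢
  simp only [Function.comp_apply]
  rw [card_filter_apply_perm κ σ]
  exact hκ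

omit [Fintype G₂] in
/-- A hop is precomposition with the transposition of the two rows. [folklore] -/
theorem hop_eq_comp_swap (h1 : (1 : G₂) ≠ 0) (κ : G₂ → Bool) (y₀ : G₂) (hy : κ y₀ = true)
    (hy' : κ (y₀ + 1) = false) : hop κ y₀ = κ ∘ Equiv.swap y₀ (y₀ + 1) := by
  funext y
  simp only [Function.comp_apply]
  by_cases h0 : y = y₀
  · subst h0
    rw [hop_apply_self h1, Equiv.swap_apply_left, hy']
  · by_cases h0' : y = y₀ + 1
    · subst h0'
      rw [hop_apply_add_one, Equiv.swap_apply_right, hy]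
    · rw [hop_apply_of_ne κ h0 h0', Equiv.swap_apply_of_ne_of_ne h0 h0']

/-- **Hops preserve balancedness.** [folklore] -/
theorem isBalancedCol_hop (h1 : (1 : G₂) ≠ 0) {κ : G₂ → Bool} (hκ : IsBalancedCol κ) (y₀ : G₂)
    (hy : κ y₀ = true) (hy' : κ (y₀ + 1) = false) : IsBalancedCol (hop κ y₀) := by
  rw [hop_eq_comp_swap h1 κ y₀ hy hy']
  exact isBalancedCol_comp_perm hκ _

/-! ## 2. Reachability: adjacent transpositions -/

/-- **An adjacent transposition of the rows is reachable**: for balanced `κ`, the column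
`κ ∘ swap(y₀, y₀+1)` is `κ` itself, a hop of `κ`, or `κ` is a hop of it; since `t_𝔅` is
symmetric, the two columns are mutually reachable in the positivity graph of `t_𝔅`.
[cite: DKLM2026SixVertexGFF, Lemma 57 (proof)] -/
theorem reach_comp_swap {c : ℝ} (hc : 0 < c) (h1 : (1 : G₂) ≠ 0) (κ : G₂ → Bool)
    (hκ : IsBalancedCol κ) (y₀ : G₂) (hκ' : IsBalancedCol (κ ∘ Equiv.swap y₀ (y₀ + 1))) :
    Reach (balancedTransferMatrix (G₂ := G₂) 1 1 c) ⟨κ, hκ⟩ ⟨κ ∘ Equiv.swap y₀ (y₀ + 1), hκ'⟩ := by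
  have hsymm : (balancedTransferMatrix (G₂ := G₂) 1 1 c).IsSymm := balancedTransferMatrix_isSymm 1 c
  have hnn : ∀ i j : {κ : G₂ → Bool // IsBalancedCol κ}, 0 ≤ balancedTransferMatrix (G₂ := G₂) 1 1 c i j :=
    fun i j => balancedTransferMatrix_nonneg zero_le_one zero_le_one hc.le i j
  rcases Bool.eq_false_or_eq_true (κ y₀) with hy | hy <;>
    rcases Bool.eq_false_or_eq_true (κ (y₀ + 1)) with hy' | hy'
  · -- (true, true): the swap does nothing
    have heq : κ ∘ Equiv.swap y₀ (y₀ + 1) = κ := by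
      funext y
      simp only [Function.comp_apply]
      rcases eq_or_ne y y₀ with rfl | h0
      · rw [Equiv.swap_apply_left, hy, hy']
      · rcases eq_or_ne y (y₀ + 1) with rfl | h0'
        · rw [Equiv.swap_apply_right, hy, hy']
        · rw [Equiv.swap_apply_of_ne_of_ne h0 h0']
    have : (⟨κ ∘ Equiv.swap y₀ (y₀ + 1), hκ'⟩ : {κ : G₂ → Bool // IsBalancedCol κ}) = ⟨κ, hκ⟩ :=
      Subtype.ext heq
    rw [this]
    exact reach_refl _ _
  · -- (true, false): a hop
    have heq : κ ∘ Equiv.swap y₀ (y₀ + 1) = hop κ y₀ := (hop_eq_comp_swap h1 κ y₀ hy hy').symm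
    have hpos : 0 < balancedTransferMatrix (G₂ := G₂) 1 1 c ⟨κ, hκ⟩ ⟨κ ∘ Equiv.swap y₀ (y₀ + 1), hκ'⟩ := by
      show 0 < transferMatrix 1 1 c κ (κ ∘ Equiv.swap y₀ (y₀ + 1))
      rw [heq]
      exact transferMatrix_hop_pos hc h1 κ y₀ hy hy'
    exact reach_of_pos hpos
  · -- (false, true): the inverse of a hop
    set κ'' := κ ∘ Equiv.swap y₀ (y₀ + 1) with hκ''
    have h''y : κ'' y₀ = true := by simp [hκ'', hy']
    have h''y' : κ'' (y₀ + 1) = false := by simp [hκ'', hy]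
    have heq : hop κ'' y₀ = κ := by
      rw [hop_eq_comp_swap h1 κ'' y₀ h''y h''y', hκ'']
      funext y
      simp [Function.comp_apply, Equiv.swap_apply_self]
    have hpos : 0 < balancedTransferMatrix (G₂ := G₂) 1 1 c ⟨κ'', hκ'⟩ ⟨κ, hκ⟩ := by
      show 0 < transferMatrix 1 1 c κ'' κ
      conv => rhs; arg 5; rw [← heq]
      exact transferMatrix_hop_pos hc h1 κ'' y₀ h''y h''y'
    exact (reach_of_pos hpos).symm hsymm
  · -- (false, false): the swap does nothing
    have heq : κ ∘ Equiv.swap y₀ (y₀ + 1) = κ := by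
      funext y
      simp only [Function.comp_apply]
      rcases eq_or_ne y y₀ with rfl | h0
      · rw [Equiv.swap_apply_left, hy, hy']
      · rcases eq_or_ne y (y₀ + 1) with rfl | h0'
        · rw [Equiv.swap_apply_right, hy, hy']
        · rw [Equiv.swap_apply_of_ne_of_ne h0 h0']
    have : (⟨κ ∘ Equiv.swap y₀ (y₀ + 1), hκ'⟩ : {κ : G₂ → Bool // IsBalancedCol κ}) = ⟨κ, hκ⟩ :=
      Subtype.ext heq
    rw [this]
    exact reach_refl _ _

end Hop

/-! ## 3. Any two balanced columns differ by a permutation of the rows -/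

section Perm

variable {α : Type*} [Fintype α] [DecidableEq α]

omit [DecidableEq α] in
/-- Two `Bool`-vectors with the same number of `true`s differ by a permutation of the index set.
[folklore] -/
theorem exists_perm_comp_eq (κ κ' : α → Bool)
    (h : (Finset.univ.filter fun y => κ y = true).card =
      (Finset.univ.filter fun y => κ' y = true).card) :
    ∃ σ : Equiv.Perm α, κ' = κ ∘ σ := by
  classical
  have hT : Fintype.card {y // κ' y = true} = Fintype.card {y // κ y = true} := by
    rw [Fintype.card_subtype, Fintype.card_subtype]
    exact h.symm
  have hF : Fintype.card {y // ¬κ' y = true} = Fintype.card {y // ¬κ y = true} := by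
    rw [Fintype.card_subtype_compl, Fintype.card_subtype_compl, hT]
  set e₁ := Fintype.equivOfCardEq hT with he₁
  set e₂ := Fintype.equivOfCardEq hF with he₂
  refine ⟨((Equiv.sumCompl fun y => κ' y = true).symm.trans (e₁.sumCongr e₂)).trans
    (Equiv.sumCompl fun y => κ y = true), funext fun y => ?_⟩
  simp only [Function.comp_apply, Equiv.trans_apply]
  by_cases hy : κ' y = true
  · rw [Equiv.sumCompl_symm_apply_of_pos (p := fun y => κ' y = true) hy, Equiv.sumCongr_apply, Sum.map_inl,
      Equiv.sumCompl_apply_inl, hy]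
    exact ((e₁ ⟨y, hy⟩).2).symm
  · rw [Equiv.sumCompl_symm_apply_of_neg (p := fun y => κ' y = true) hy, Equiv.sumCongr_apply, Sum.map_inr,
      Equiv.sumCompl_apply_inr]
    have h2 := (e₂ ⟨y, hy⟩).2
    simp only [Bool.not_eq_true] at hy h2
    rw [hy, h2]

end Perm

/-! ## 4. All balanced columns are mutually reachable; Lemma 57 -/

section SingleBlock

/-- Equal indices are reachable. [folklore] -/
theorem reach_of_eq {m : Type*} [Fintype m] [DecidableEq m] (A : Matrix m m ℝ) {i j : m}
    (h : i = j) : Reach A i j :=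
  h ▸ reach_refl A i

/-- **Irreducibility of `t_𝔅` on balanced columns** ("a single block"): for `c > 0` and `L ≥ 2`,
any two balanced column configurations of `ZMod L` are connected in the positivity graph of the
balanced transfer matrix (adjacent transpositions generate all permutations of the rows, and each
is the identity, a hop or an inverse hop on a balanced column).
[cite: DKLM2026SixVertexGFF, Lemma 57] -/
theorem reach_balancedTransferMatrix {c : ℝ} (hc : 0 < c) (n : ℕ) (hn : 1 ≤ n)
    (i j : {κ : ZMod (n + 1) → Bool // IsBalancedCol κ}) :
    Reach (balancedTransferMatrix (G₂ := ZMod (n + 1)) 1 1 c) i j := by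
  haveI : Fact (1 < n + 1) := ⟨by omega⟩
  have h1 : (1 : ZMod (n + 1)) ≠ 0 := one_ne_zero
  have hnn : ∀ i j : {κ : ZMod (n + 1) → Bool // IsBalancedCol κ},
      0 ≤ balancedTransferMatrix (G₂ := ZMod (n + 1)) 1 1 c i j :=
    fun i j => balancedTransferMatrix_nonneg zero_le_one zero_le_one hc.le i j
  obtain ⟨κ, hκ⟩ := i
  obtain ⟨κ', hκ'⟩ := j
  obtain ⟨σ, rfl⟩ : ∃ σ : Equiv.Perm (ZMod (n + 1)), κ' = κ ∘ σ := by
    refine exists_perm_comp_eq κ κ' ?_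
    have h₁ : 2 * (Finset.univ.filter fun y => κ y = true).card = Fintype.card (ZMod (n + 1)) := hκ
    have h₂ : 2 * (Finset.univ.filter fun y => κ' y = true).card = Fintype.card (ZMod (n + 1)) := hκ'
    omega
  have hmem : σ ∈ Submonoid.closure (Set.range fun p : Fin n => Equiv.swap p.castSucc p.succ) := by
    rw [Equiv.Perm.mclosure_swap_castSucc_succ]
    exact Submonoid.mem_top σ
  revert hκ'
  induction hmem using Submonoid.closure_induction generalizing κ with
  | mem τ hτ =>
    obtain ⟨p, rfl⟩ := hτ
    intro hκ'
    have hb : IsBalancedCol (κ ∘ ⇑(Equiv.swap (p.castSucc : ZMod (n + 1))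
        ((p.castSucc : ZMod (n + 1)) + 1))) := isBalancedCol_comp_perm hκ _
    convert reach_comp_swap hc h1 κ hκ (p.castSucc : ZMod (n + 1)) hb using 5
    exact congrArg (Equiv.swap (p.castSucc : ZMod (n + 1))) (Fin.coeSucc_eq_succ (a := p)).symm
  | one =>
    intro hκ'
    exact reach_of_eq _ (Subtype.ext (funext fun _ => rfl))
  | mul σ τ _ _ ihσ ihτ =>
    intro hκ'
    have hκσ : IsBalancedCol (κ ∘ σ) := isBalancedCol_comp_perm hκ σ
    exact (ihσ κ hκ hκσ).trans hnn (ihτ (κ ∘ σ) hκσ hκ')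

/-- **Lemma 57: `t(π/2)` has a single block** — some power of the balanced transfer matrix is
entrywise positive (`a = b = 1`, `c > 0`, circumference `L = n + 1 ≥ 2`).
[cite: DKLM2026SixVertexGFF, Lemma 57] -/
theorem exists_balancedTransferMatrix_pow_pos {c : ℝ} (hc : 0 < c) (n : ℕ) (hn : 1 ≤ n) :
    ∃ m : ℕ, ∀ i j : {κ : ZMod (n + 1) → Bool // IsBalancedCol κ},
      0 < (balancedTransferMatrix (G₂ := ZMod (n + 1)) 1 1 c ^ m) i j :=
  exists_pow_apply_pos (fun i j => balancedTransferMatrix_nonneg zero_le_one zero_le_one hc.le i j)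
    (fun i => balancedTransferMatrix_diag_pos zero_lt_one zero_lt_one hc.le i)
    (reach_balancedTransferMatrix hc n hn)

/-- **Lemma 57 / Remark 58: the largest eigenvalue of `t(π/2)` is simple** — for `a = b = 1`,
`c > 0` and even circumference `L = 2(ℓ+1)`, the top eigenvalue `Λ` of the balanced transfer
matrix is listed exactly once (`d = 1` in eq. (cylop)). [cite: DKLM2026SixVertexGFF, Lemma 57 and Remark 58] -/
theorem card_filter_eigenvalues_balancedTransferMatrix_eq_one {c : ℝ} (hc : 0 < c) (ℓ : ℕ) :
    (Finset.univ.filter fun i =>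
        (balancedTransferMatrix_isHermitian (G₂ := ZMod (2 * (ℓ + 1))) 1 c).eigenvalues i =
          topEigenvalue (balancedTransferMatrix_isHermitian (G₂ := ZMod (2 * (ℓ + 1))) 1 c)).card = 1 := by
  obtain ⟨m, hm⟩ := exists_balancedTransferMatrix_pow_pos hc (2 * ℓ + 1) (by omega)
  set δ : ℝ := Finset.univ.inf' Finset.univ_nonempty
    (fun i => balancedTransferMatrix (G₂ := ZMod (2 * (ℓ + 1))) 1 1 c i i) with hδ
  have hδpos : 0 < δ := by
    obtain ⟨i₀, -, h⟩ := Finset.exists_mem_eq_inf' Finset.univ_nonempty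
      (fun i => balancedTransferMatrix (G₂ := ZMod (2 * (ℓ + 1))) 1 1 c i i)
    rw [hδ, h]
    exact balancedTransferMatrix_diag_pos zero_lt_one zero_lt_one hc.le i₀
  have hdiag : ∀ i, δ ≤ balancedTransferMatrix (G₂ := ZMod (2 * (ℓ + 1))) 1 1 c i i :=
    fun i => Finset.inf'_le _ (Finset.mem_univ i)
  exact card_filter_eigenvalues_eq_topEigenvalue_eq_one_of_pow_pos
    (balancedTransferMatrix_isHermitian 1 c)
    (fun i j _ => balancedTransferMatrix_nonneg zero_le_one zero_le_one hc.le i j) hδpos hdiag hm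

/-- **Lemma 57: a Perron vector** — the balanced transfer matrix has an eigenvector with
positive entries for its largest eigenvalue (`v_0`). [cite: DKLM2026SixVertexGFF, Lemma 57] -/
theorem exists_pos_eigenvector_balancedTransferMatrix {c : ℝ} (hc : 0 < c) (ℓ : ℕ) :
    ∃ v : {κ : ZMod (2 * (ℓ + 1)) → Bool // IsBalancedCol κ} → ℝ, (∀ i, 0 < v i) ∧
      balancedTransferMatrix 1 1 c *ᵥ v =
        topEigenvalue (balancedTransferMatrix_isHermitian (G₂ := ZMod (2 * (ℓ + 1))) 1 c) • v := by
  obtain ⟨m, hm⟩ := exists_balancedTransferMatrix_pow_pos hc (2 * ℓ + 1) (by omega)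
  set δ : ℝ := Finset.univ.inf' Finset.univ_nonempty
    (fun i => balancedTransferMatrix (G₂ := ZMod (2 * (ℓ + 1))) 1 1 c i i) with hδ
  have hδpos : 0 < δ := by
    obtain ⟨i₀, -, h⟩ := Finset.exists_mem_eq_inf' Finset.univ_nonempty
      (fun i => balancedTransferMatrix (G₂ := ZMod (2 * (ℓ + 1))) 1 1 c i i)
    rw [hδ, h]
    exact balancedTransferMatrix_diag_pos zero_lt_one zero_lt_one hc.le i₀
  have hdiag : ∀ i, δ ≤ balancedTransferMatrix (G₂ := ZMod (2 * (ℓ + 1))) 1 1 c i i :=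
    fun i => Finset.inf'_le _ (Finset.mem_univ i)
  exact exists_pos_eigenvector_of_pow_pos (balancedTransferMatrix_isHermitian 1 c)
    (fun i j _ => balancedTransferMatrix_nonneg zero_le_one zero_le_one hc.le i j) hδpos hdiag hm

end SingleBlock

end Literature.Probability.LatticeModels.SixVertex

end
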